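import Literature.MathematicalPhysics.QuantumFieldTheory.Balaban1983to89.B12QPrime348
import Mathlib.Analysis.Calculus.FDeriv.Analytic
import Mathlib.Analysis.Calculus.Deriv.Prod
import Mathlib.Analysis.Calculus.Deriv.Add
import Mathlib.Analysis.Calculus.Deriv.Mul

/-!
# `Balaban1983to89.B12Eq46` — [Balaban1987RG1] (4.6) p. 282: the `t_□`-derivative at `t_□ = 0` of the Taylor polynomial
`Σ_{n≤4} (1/n!)⟨(δⁿ/δBⁿ)𝐄^{(j)}(X, U_j(□₀,1)), ⊗ⁿB⟩` and the variation `δB`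

HONEST FRAMING (cell `lit-balaban`, verbatim): statement-level skeleton of published theorems with citation tags; proofs
where landed; nothing here is a claim about the Yang–Mills mass gap.

CITATION HEADER.  T. Bałaban, *Renormalization group approach to lattice gauge field theories. I. Generation of
effective actions in a small field approximation and a coupling constant renormalization in four dimensions*,
Commun. Math. Phys. **109** (1987) 249–301, doi:10.1007/bf01215223 [Balaban1987RG1] (cell paper B12; held text
`paper:balaban1987-cmp109-rg-i-small-field`, journal page = PDF page + 248; the display was read as an image from the page
render `b2b-balaban-ref1/pages/1987-cmp109-rg-I-small-field/…-p034-x2.png` (p. 282)).  Unit `lit-balaban-r20` (fold owner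
of B12), SKELETON row `B12.Eq4.6` (reader r09: «absent — only the (4.20) sum shape `B12Marginal444.sum420` exists; Λ, δ𝐁
formulas not typed»).  Consumers in print: (4.19)–(4.20) (the kernels `E^{(n)}`), §5.

WHAT IS PRINTED (p. 282 [PDF 34], verbatim).  *«We have to consider the terms with m = n only. They are localized in □̃⁴,
hence the function ζ̃_□B is defined on the unit lattice T₁^{(j)}. We denote it simply by B again, hence B = ζ̃_□Q_j(ηA).
At this point it is convenient to perform the differentiation with respect to t_□, at t_□ = 0. We replace the function 𝐀
by (tζ̃_□ + t_□ζ_□)𝐇_k(B′), and we differentiate the sum over n. It is a simple polynomial in B, and the differentiation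
yields
  Σ_{n=1}^{4} (1/(n−1)!) ⟨(δⁿ/δBⁿ)𝐄^{(j)}(X, U_j(□₀, 1)), δB, ⊗^{n−1}B⟩,
  δB = ⟨((δ/δA)Q_j)(ηA), η⟨(δ/δ𝐀)Λ, ζ_□𝐇_j(B′)⟩⟩,                                   (4.6)
  A = Λ(tζ̃_□𝐇_k(B′), L⁻¹𝐇_{k+1}(□₀, (1/i) log V)),
where Λ(𝐀, 𝐁) = (1/iη) log exp iη𝐀 exp iη𝐁.»*  (In print `Λ` is a script `A`; «the sum over n» is the Taylor polynomial
`Σ_{n=0}^{4} (1/n!)⟨(δⁿ/δBⁿ)𝐄^{(j)}(X, U_j(□₀,1)), ⊗ⁿB⟩` of (3.34).  TRANSCRIPTION NOTE: the print has `𝐇_j(B′)` inside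
`δB` where the surrounding text has `𝐇_k(B′)`; the SKELETON cell of r09 read the sum as starting at n = 2 — the render
shows n = 1.)

HOW IT IS FORMALIZED.  Over real normed spaces `E` (the fields `B`), `F` (values, complete not needed) and `EA` (the fields
𝐀, `A`):
* the «sum over n» is `taylorPoly4 p B := Σ_{n<5} (n!)⁻¹ • p n (B,…,B)` for a `FormalMultilinearSeries ℝ E F` `p`
  (`p n = (δⁿ/δBⁿ)𝐄^{(j)}(X, U_j(□₀,1))`, an `n`-linear continuous map);
* §1, product rule [elementary API]: `t ↦ m(B(t),…,B(t))` has derivative `Σ_i m(B,…,B′,…,B)` (Mathlib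
  `ContinuousMultilinearMap.hasFDerivAt` BY NAME, composed with the curve), and for SYMMETRIC `m` this is
  `n·m(B′, B,…,B)` (`sum_update_const_eq_smul`);
* §2, **`hasDerivAt_taylorPoly4`**: for symmetric `p n` and a curve `B(τ)` with `B′(0) = δB`,
  `(d/dτ)|₀ taylorPoly4 p (B τ) = Σ_{n<4} (n!)⁻¹ • p (n+1) (δB, B(0),…,B(0))` — the printed
  `Σ_{n=1}^{4} (1/(n−1)!)⟨pₙ, δB, ⊗^{n−1}B⟩` re-indexed `n ↦ n+1` (`deriv_taylorPoly4` is the `deriv` form);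
* §3, **`hasDerivAt_deltaB`**: with `𝐀(t_□) = x + t_□v` (`x = tζ̃_□𝐇_k(B′)`, `v = ζ_□𝐇_k(B′)`), `A = Λ(𝐀)` and
  `B = Q(ηA)`, `(d/dt_□)|₀ Q(ηΛ(x + t_□v)) = ⟨(δQ/δA)(ηΛ(x)), η⟨(δΛ/δ𝐀)(x), v⟩⟩ = δB` (the chain rule
  `B12QPrime348.fderiv_Q_comp_apply` along the line `B12FirstExpansion34.hasDerivAt_tbox`, BY NAME);
* §4, **`eq46`**: the two assembled — the display (4.6).
The SYMMETRY of `p n` (`p n (w ∘ σ) = p n w`) is a HYPOTHESIS: in print it holds because `p n` is an `n`-th Fréchet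
derivative (Schwarz); Mathlib currently provides the symmetry of iterated derivatives at order 2 only
(`ContDiffAt.isSymmSndFDerivAt`), so the general-order fact is not imported here.  The localisation factors `ζ̃_□`, `ζ_□`
are absorbed in the abstract vectors `x`, `v` and in `Q` (multiplication by `ζ̃_□` is linear); «localized in □» is not
modelled.  No `def … : Prop` fact is introduced; `taylorPoly4` is an object.
DOCFIX (r20 g20, 2026-08-22): the §(4.20) quotation of p. 284 now carries the words it elided («this is possible only for the element 0 in the
algebra 𝐠ᶜ. Thus we have the first, very important consequence of the gauge invariance») — QF57-006 (summit-lit1 g57, confirmed r09 g19 / r20 g20 on p0036 L12–16); comment-only, declarations byte-identical.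
-/

namespace Literature.MathematicalPhysics.QuantumFieldTheory.Balaban1983to89.B12Eq46

open scoped BigOperators Nat
open Literature.MathematicalPhysics.QuantumFieldTheory.Balaban1983to89

variable {E F : Type*} [NormedAddCommGroup E] [NormedSpace ℝ E] [NormedAddCommGroup F] [NormedSpace ℝ F]

/-! ## §1  Product rule for `t ↦ m(B(t), …, B(t))` and its symmetric collapse -/

/-- Product rule along a curve for an `n`-linear continuous map: if `B′(t) = δ` then
`(d/dt) m(B(t),…,B(t)) = Σ_i m(B(t),…, δ (slot i), …, B(t))` (Mathlib `ContinuousMultilinearMap.hasFDerivAt` composed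
with the curve). [cite: Balaban1987RG1, (4.6) p.282] (elementary API: «It is a simple polynomial in B, and the
differentiation yields …»; standard calculus, our proof) -/
theorem hasDerivAt_multilinear_comp_const {n : ℕ} (m : E [×n]→L[ℝ] F) {B : ℝ → E} {δ : E} {t : ℝ}
    (hB : HasDerivAt B δ t) :
    HasDerivAt (fun s => m (fun _ : Fin n => B s)) (∑ i : Fin n, m (Function.update (fun _ => B t) i δ)) t := by
  classical
  have h1 : HasDerivAt (fun s => fun _ : Fin n => B s) (fun _ : Fin n => δ) t := hasDerivAt_pi.2 fun _ => hB
  have h2 : HasDerivAt (fun s => m (fun _ : Fin n => B s)) ((m.linearDeriv fun _ : Fin n => B t) fun _ => δ) t :=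
    (m.hasFDerivAt (fun _ : Fin n => B t)).comp_hasDerivAt t h1
  refine h2.congr_deriv ?_
  rw [ContinuousMultilinearMap.linearDeriv_apply]

omit [NormedAddCommGroup E] [NormedSpace ℝ E] in
/-- Moving the distinguished slot: for the constant family `(b,…,b)` with `δ` put in slot `i`, precomposition with the
transposition `(0 i)` moves `δ` to slot `0`. [cite: Balaban1987RG1, (4.6) p.282] (elementary API; combinatorics, our
proof) -/
theorem update_const_zero_comp_swap {n : ℕ} (b δ : E) (i : Fin (n + 1)) :
    (Function.update (fun _ : Fin (n + 1) => b) 0 δ) ∘ (Equiv.swap 0 i) = Function.update (fun _ => b) i δ := by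
  ext j
  simp only [Function.comp_apply, Function.update_apply]
  by_cases hj : j = i
  · subst hj
    simp
  · rcases eq_or_ne j 0 with rfl | hj0
    · rw [Equiv.swap_apply_left]
      simp [hj, Ne.symm hj]
    · rw [Equiv.swap_apply_of_ne_of_ne hj0 hj]
      simp [hj, hj0]

/-- **Symmetric collapse**: for a SYMMETRIC `(n+1)`-linear map `m` (in print: an `(n+1)`-st Fréchet derivative),
`Σ_i m(b,…, δ (slot i), …, b) = (n+1)·m(δ, b, …, b)`. [cite: Balaban1987RG1, (4.6) p.282] (elementary API: the step
from the product rule to the printed coefficient `1/(n−1)!`; our proof) -/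
theorem sum_update_const_eq_smul {n : ℕ} (m : E [×(n + 1)]→L[ℝ] F)
    (hsymm : ∀ (σ : Equiv.Perm (Fin (n + 1))) (w : Fin (n + 1) → E), m (w ∘ σ) = m w) (b δ : E) :
    ∑ i : Fin (n + 1), m (Function.update (fun _ => b) i δ) =
      (n + 1) • m (Function.update (fun _ : Fin (n + 1) => b) 0 δ) := by
  have key : ∀ i : Fin (n + 1),
      m (Function.update (fun _ => b) i δ) = m (Function.update (fun _ : Fin (n + 1) => b) 0 δ) := by
    intro i
    rw [← update_const_zero_comp_swap b δ i, hsymm]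
  simp [key, Finset.sum_const, Finset.card_univ, Fintype.card_fin]

/-! ## §2  The «simple polynomial in B» and its `t_□`-derivative -/

/-- The «sum over n» of p. 282 = the Taylor polynomial of (3.34) without its remainder:
`taylorPoly4 p B = Σ_{n=0}^{4} (1/n!)⟨p n, ⊗ⁿB⟩` for a formal multilinear series `p` (`p n = (δⁿ/δBⁿ)𝐄^{(j)}(X, U_j(□₀,1))`).
[cite: Balaban1987RG1, (3.34) p.277; (4.6) p.282] -/
noncomputable def taylorPoly4 (p : FormalMultilinearSeries ℝ E F) (B : E) : F :=
  ∑ n ∈ Finset.range 5, ((n ! : ℝ)⁻¹) • p n (fun _ => B)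

/-- Term-by-term derivative of the Taylor polynomial along a curve (no symmetry used):
`(d/dτ) taylorPoly4 p (B τ) = Σ_{n<5} (n!)⁻¹ • Σ_i p n (B,…, B′ (slot i), …, B)`. [cite: Balaban1987RG1, (4.6) p.282]
(elementary API; our proof) -/
theorem hasDerivAt_taylorPoly4_raw (p : FormalMultilinearSeries ℝ E F) {B : ℝ → E} {δB : E} {τ : ℝ}
    (hB : HasDerivAt B δB τ) :
    HasDerivAt (fun s => taylorPoly4 p (B s))
      (∑ n ∈ Finset.range 5, ((n ! : ℝ)⁻¹) • ∑ i : Fin n, p n (Function.update (fun _ => B τ) i δB)) τ := by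
  have hterm : ∀ n ∈ Finset.range 5, HasDerivAt (fun s => ((n ! : ℝ)⁻¹) • p n (fun _ : Fin n => B s))
      (((n ! : ℝ)⁻¹) • ∑ i : Fin n, p n (Function.update (fun _ => B τ) i δB)) τ :=
    fun n _ => (hasDerivAt_multilinear_comp_const (p n) hB).const_smul _
  have h := HasDerivAt.fun_sum hterm
  simpa [taylorPoly4] using h

/-- Re-indexing with the symmetric collapse: `Σ_{n<5} (n!)⁻¹ • Σ_i p n (…δ in slot i…) = Σ_{n<4} (n!)⁻¹ • p (n+1) (δ, b, …, b)`
for symmetric `p (n+1)` — the `n = 0` term vanishes and `(n+1)/(n+1)! = 1/n!`. [cite: Balaban1987RG1, (4.6) p.282]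
(elementary API; our proof) -/
theorem sum_range_five_collapse (p : FormalMultilinearSeries ℝ E F)
    (hsymm : ∀ (n : ℕ) (σ : Equiv.Perm (Fin (n + 1))) (w : Fin (n + 1) → E), p (n + 1) (w ∘ σ) = p (n + 1) w)
    (b δ : E) :
    ∑ n ∈ Finset.range 5, ((n ! : ℝ)⁻¹) • ∑ i : Fin n, p n (Function.update (fun _ => b) i δ) =
      ∑ n ∈ Finset.range 4, ((n ! : ℝ)⁻¹) • p (n + 1) (Function.update (fun _ : Fin (n + 1) => b) 0 δ) := by
  rw [Finset.sum_range_succ' _ 4]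
  simp only [Finset.univ_eq_empty, Finset.sum_empty, smul_zero, add_zero]
  refine Finset.sum_congr rfl fun n _ => ?_
  rw [sum_update_const_eq_smul (p (n + 1)) (hsymm n) b δ, smul_comm, ← Nat.cast_smul_eq_nsmul ℝ, smul_smul]
  congr 1
  rw [Nat.factorial_succ, Nat.cast_mul]
  have h1 : ((n + 1 : ℕ) : ℝ) ≠ 0 := by positivity
  have h2 : ((n ! : ℕ) : ℝ) ≠ 0 := by positivity
  field_simp

/-- **(4.6), the differentiated «sum over n»**: for a formal multilinear series `p` with SYMMETRIC terms (`p n =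
(δⁿ/δBⁿ)𝐄^{(j)}(X, U_j(□₀,1))`) and a curve `B(τ)` with `B(0) = B₀`, `B′(0) = δB`,
`(d/dτ)|₀ Σ_{n=0}^{4} (1/n!)⟨p n, ⊗ⁿB(τ)⟩ = Σ_{n=1}^{4} (1/(n−1)!)⟨p n, δB, ⊗^{n−1}B₀⟩` (written with `n ↦ n+1`:
`Σ_{n<4} (n!)⁻¹ • p (n+1) (δB, B₀, …, B₀)`). [cite: Balaban1987RG1, (4.6) p.282] -/
theorem hasDerivAt_taylorPoly4 (p : FormalMultilinearSeries ℝ E F)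
    (hsymm : ∀ (n : ℕ) (σ : Equiv.Perm (Fin (n + 1))) (w : Fin (n + 1) → E), p (n + 1) (w ∘ σ) = p (n + 1) w)
    {B : ℝ → E} {B₀ δB : E} (hB : HasDerivAt B δB 0) (hB₀ : B 0 = B₀) :
    HasDerivAt (fun s => taylorPoly4 p (B s))
      (∑ n ∈ Finset.range 4, ((n ! : ℝ)⁻¹) • p (n + 1) (Function.update (fun _ : Fin (n + 1) => B₀) 0 δB)) 0 := by
  have h := hasDerivAt_taylorPoly4_raw p hB
  rw [hB₀, sum_range_five_collapse p hsymm B₀ δB] at h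
  exact h

/-- `deriv` form of `hasDerivAt_taylorPoly4`. [cite: Balaban1987RG1, (4.6) p.282] -/
theorem deriv_taylorPoly4 (p : FormalMultilinearSeries ℝ E F)
    (hsymm : ∀ (n : ℕ) (σ : Equiv.Perm (Fin (n + 1))) (w : Fin (n + 1) → E), p (n + 1) (w ∘ σ) = p (n + 1) w)
    {B : ℝ → E} {B₀ δB : E} (hB : HasDerivAt B δB 0) (hB₀ : B 0 = B₀) :
    deriv (fun s => taylorPoly4 p (B s)) 0 =
      ∑ n ∈ Finset.range 4, ((n ! : ℝ)⁻¹) • p (n + 1) (Function.update (fun _ : Fin (n + 1) => B₀) 0 δB) :=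
  (hasDerivAt_taylorPoly4 p hsymm hB hB₀).deriv

/-! ## §3  The variation `δB` by the chain rule -/

section DeltaB

variable {EA : Type*} [NormedAddCommGroup EA] [NormedSpace ℝ EA]

/-- **(4.6), `δB`**: with `𝐀(t_□) = x + t_□v` (`x = tζ̃_□𝐇_k(B′)`, `v = ζ_□𝐇_k(B′)`), `A = Λ(𝐀)` (`Λ = Λ(·, L⁻¹𝐇_{k+1})`,
differentiable at `x`) and `B = Q(ηA)` (`Q` differentiable at `ηΛ(x)`),
`(d/dt_□)|₀ Q(ηΛ(x + t_□v)) = ⟨((δ/δA)Q)(ηΛ(x)), η⟨((δ/δ𝐀)Λ)(x), v⟩⟩ = δB`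
(`B12QPrime348.fderiv_Q_comp_apply` along the line `B12FirstExpansion34.hasDerivAt_tbox`, BY NAME).
[cite: Balaban1987RG1, (4.6) p.282] -/
theorem hasDerivAt_deltaB {Q : EA → E} {Λ : EA → EA} {η : ℝ} {x : EA} (v : EA)
    (hQ : DifferentiableAt ℝ Q (η • Λ x)) (hΛ : DifferentiableAt ℝ Λ x) :
    HasDerivAt (fun τ : ℝ => Q (η • Λ (x + τ • v))) (fderiv ℝ Q (η • Λ x) (η • fderiv ℝ Λ x v)) 0 := by
  have hcomp : DifferentiableAt ℝ (fun a => Q (η • Λ a)) x := hQ.comp x (hΛ.const_smul η)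
  have h := B12FirstExpansion34.hasDerivAt_tbox (f := fun a => Q (η • Λ a)) v hcomp
  rw [B12QPrime348.fderiv_Q_comp_apply v hQ hΛ] at h
  exact h

end DeltaB

/-! ## §4  (4.6) assembled -/

section Assembled

variable {EA : Type*} [NormedAddCommGroup EA] [NormedSpace ℝ EA]

/-- **(4.6)** p. 282 [PDF 34]: for the symmetric derivatives `p n = (δⁿ/δBⁿ)𝐄^{(j)}(X, U_j(□₀,1))`, the averaging `Q`
(`= Q_j(η·)`, differentiable at `ηA`), `Λ = Λ(·, L⁻¹𝐇_{k+1}(□₀,(1/i) log V))` (differentiable at `x`), `𝐀(t_□) = x + t_□v`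
(`x = tζ̃_□𝐇_k(B′)`, `v = ζ_□𝐇_k(B′)`), `A = Λ(x)`, `B = Q(ηA)`:
`(∂/∂t_□)|₀ Σ_{n=0}^{4} (1/n!)⟨p n, ⊗ⁿ Q(ηΛ(𝐀(t_□)))⟩ = Σ_{n=1}^{4} (1/(n−1)!)⟨p n, δB, ⊗^{n−1}B⟩`,
`δB = ⟨((δ/δA)Q)(ηA), η⟨((δ/δ𝐀)Λ)(x), v⟩⟩` (right member written with `n ↦ n+1`).
[cite: Balaban1987RG1, (4.6) p.282] -/
theorem eq46 (p : FormalMultilinearSeries ℝ E F)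
    (hsymm : ∀ (n : ℕ) (σ : Equiv.Perm (Fin (n + 1))) (w : Fin (n + 1) → E), p (n + 1) (w ∘ σ) = p (n + 1) w)
    {Q : EA → E} {Λ : EA → EA} {η : ℝ} {x : EA} (v : EA)
    (hQ : DifferentiableAt ℝ Q (η • Λ x)) (hΛ : DifferentiableAt ℝ Λ x) :
    HasDerivAt (fun τ : ℝ => taylorPoly4 p (Q (η • Λ (x + τ • v))))
      (∑ n ∈ Finset.range 4, ((n ! : ℝ)⁻¹) •
        p (n + 1) (Function.update (fun _ : Fin (n + 1) => Q (η • Λ x)) 0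
          (fderiv ℝ Q (η • Λ x) (η • fderiv ℝ Λ x v)))) 0 :=
  hasDerivAt_taylorPoly4 p hsymm (hasDerivAt_deltaB v hQ hΛ) (by simp)

/-- `deriv` form of (4.6). [cite: Balaban1987RG1, (4.6) p.282] -/
theorem eq46_deriv (p : FormalMultilinearSeries ℝ E F)
    (hsymm : ∀ (n : ℕ) (σ : Equiv.Perm (Fin (n + 1))) (w : Fin (n + 1) → E), p (n + 1) (w ∘ σ) = p (n + 1) w)
    {Q : EA → E} {Λ : EA → EA} {η : ℝ} {x : EA} (v : EA)
    (hQ : DifferentiableAt ℝ Q (η • Λ x)) (hΛ : DifferentiableAt ℝ Λ x) :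
    deriv (fun τ : ℝ => taylorPoly4 p (Q (η • Λ (x + τ • v)))) 0 =
      ∑ n ∈ Finset.range 4, ((n ! : ℝ)⁻¹) •
        p (n + 1) (Function.update (fun _ : Fin (n + 1) => Q (η • Λ x)) 0
          (fderiv ℝ Q (η • Λ x) (η • fderiv ℝ Λ x v))) :=
  (eq46 p hsymm v hQ hΛ).deriv

end Assembled

/-! ## (4.20) — the sum (4.6) after (4.14): «we can drop the term with n = 1» (v1.1, same seat)

[I] p. 284 [PDF 36], verbatim: «The group G is semisimple, hence this is possible only for the element 0 in the algebra 𝐠ᶜ.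
Thus we have the first, very important consequence of the gauge invariance (δ/δB)𝐄(1) = 0. (4.14) This equality simplifies
the identities, and also the sum (4.6), we can drop the term with n = 1.»  [I] p. 285 [PDF 37], verbatim: «We begin the analysis
of (4.6) introducing simpler notations. We drop the superscript (j) … (4.6) = Σ_{n=2}^{4} (1/(n−1)!) ⟨𝐄^{(n)}, δB,
⊗^{n−1}B⟩. (4.20)»  In the abstract form of `eq46` (the «sum over n» as the Taylor polynomial of a formal multilinear
series `p`, `p n` = δⁿ𝐄/δBⁿ), (4.14) is the hypothesis `p 1 = 0`, and (4.20) is (4.6) with the `n = 1` summand removed: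
written with the shifted index `n + 1 = 2, 3, 4`, i.e. `n ∈ Finset.Ico 1 4`, coefficient `1/n! = 1/((n+1)−1)!`.  The row
B12.Eq4.19-4.20 of record is the concrete kernel form `B12Marginal444.sum420`; this is the LINK (4.6) + (4.14) ⇒ (4.20) for
the abstract carriers of this file (no claim on that row's head). -/

section Eq420

variable {EA : Type*} [NormedAddCommGroup EA] [NormedSpace ℝ EA]

/-- **(4.20) from (4.6) and (4.14)**: if the first functional derivative vanishes, `p 1 = 0` ((4.14): «G is semisimple,
hence (δ/δB)𝐄(1) = 0 … we can drop the term with n = 1»), then the derivative (4.6) of the sum over `n` along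
`τ ↦ Q(ηΛ(x + τv))` equals `Σ_{n+1 = 2}^{4} (1/n!)⟨δ^{n+1}𝐄/δB^{n+1}, δB, ⊗ⁿB⟩` — the printed (4.20)
«(4.6) = Σ_{n=2}^{4} (1/(n−1)!)⟨𝐄^{(n)}, δB, ⊗^{n−1}B⟩» (index shifted by one; symmetry of the derivatives carried as the
hypothesis `hsymm`, as in `eq46`). [cite: Balaban1987RG1, (4.14) p.284, (4.20) p.285, (4.6) p.282] -/
theorem eq420_of_eq414 (p : FormalMultilinearSeries ℝ E F)
    (hsymm : ∀ (n : ℕ) (σ : Equiv.Perm (Fin (n + 1))) (w : Fin (n + 1) → E), p (n + 1) (w ∘ σ) = p (n + 1) w)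
    (h414 : p 1 = 0)
    {Q : EA → E} {Λ : EA → EA} {η : ℝ} {x : EA} (v : EA)
    (hQ : DifferentiableAt ℝ Q (η • Λ x)) (hΛ : DifferentiableAt ℝ Λ x) :
    HasDerivAt (fun τ : ℝ => taylorPoly4 p (Q (η • Λ (x + τ • v))))
      (∑ n ∈ Finset.Ico 1 4, ((n ! : ℝ)⁻¹) •
        p (n + 1) (Function.update (fun _ : Fin (n + 1) => Q (η • Λ x)) 0
          (fderiv ℝ Q (η • Λ x) (η • fderiv ℝ Λ x v)))) 0 := by
  have h := eq46 p hsymm v hQ hΛ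
  rw [Finset.range_eq_Ico, Finset.sum_eq_sum_Ico_succ_bot (by norm_num : (0 : ℕ) < 4)] at h
  simpa [h414] using h

/-- `deriv` form of (4.20) (from (4.6) and (4.14)). [cite: Balaban1987RG1, (4.20) p.285, (4.14) p.284] -/
theorem eq420_deriv_of_eq414 (p : FormalMultilinearSeries ℝ E F)
    (hsymm : ∀ (n : ℕ) (σ : Equiv.Perm (Fin (n + 1))) (w : Fin (n + 1) → E), p (n + 1) (w ∘ σ) = p (n + 1) w)
    (h414 : p 1 = 0)
    {Q : EA → E} {Λ : EA → EA} {η : ℝ} {x : EA} (v : EA)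
    (hQ : DifferentiableAt ℝ Q (η • Λ x)) (hΛ : DifferentiableAt ℝ Λ x) :
    deriv (fun τ : ℝ => taylorPoly4 p (Q (η • Λ (x + τ • v)))) 0 =
      ∑ n ∈ Finset.Ico 1 4, ((n ! : ℝ)⁻¹) •
        p (n + 1) (Function.update (fun _ : Fin (n + 1) => Q (η • Λ x)) 0
          (fderiv ℝ Q (η • Λ x) (η • fderiv ℝ Λ x v))) :=
  (eq420_of_eq414 p hsymm h414 v hQ hΛ).deriv

/-- The (4.20) sum written out: three terms, `n + 1 = 2, 3, 4`, coefficients `1/1!, 1/2!, 1/3!` = the printed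
`1/(n−1)!`. [cite: Balaban1987RG1, (4.20) p.285] (elementary API; our unfolding) -/
theorem sum420_three_terms (g : ℕ → F) :
    ∑ n ∈ Finset.Ico 1 4, ((n ! : ℝ)⁻¹) • g n = g 1 + (2 : ℝ)⁻¹ • g 2 + (6 : ℝ)⁻¹ • g 3 := by
  rw [Finset.sum_eq_sum_Ico_succ_bot (by norm_num : (1 : ℕ) < 4),
    Finset.sum_eq_sum_Ico_succ_bot (by norm_num : (2 : ℕ) < 4),
    Finset.sum_eq_sum_Ico_succ_bot (by norm_num : (3 : ℕ) < 4), Finset.Ico_self, Finset.sum_empty, add_zero]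
  norm_num [Nat.factorial, add_assoc]

end Eq420

end Literature.MathematicalPhysics.QuantumFieldTheory.Balaban1983to89.B12Eq46
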